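import Literature.AlgebraicGeometry.AbelianSchemes.PolarizationSpreadStageAmpleLocus
import Literature.AlgebraicGeometry.AbelianSchemes.LDeltaIsLambdaOfAtSqStage
import Literature.AlgebraicGeometry.AbelianSchemes.IsLambdaOfAtRootOfSquareAtPoint
import Literature.AlgebraicGeometry.AbelianSchemes.AbelianSchemeDualTransportOfBaseChange
import Literature.AlgebraicGeometry.AbelianSchemes.DualPairHatRelDimTransport
import Literature.AlgebraicGeometry.AbelianSchemes.IsLambdaOfAtSquareRootOfTwoNeZero
import Literature.AlgebraicGeometry.AbelianSchemes.DualPairDimEq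
import Literature.AlgebraicGeometry.AbelianSchemes.PolarizationNormalizeBaseChange
import HarnessLib

/-!
# SPREAD SEQUEL (s2-λ), THE CLOSER: a polarization of the GENERIC base change of a stage abelian scheme spreads to a ★ `Polarization`
# over a finer stage — modulo the characteristic-`p` HALVING only ([MumfordFogartyKirwan1994] Def. 6.3, Prop. 6.10; [GortzWedhorn2023] Cor. 27.285)

Layer `Literature/AlgebraicGeometry/AbelianSchemes`, namespace `Literature.AlgebraicGeometry.AbelianSchemes.AbelianSchemeOver`.  THEOREMS ONLY
(no definition, no named fact, no instance, no notation, no `sorry`); universe `Scheme.{0}` (that of ★ «AmpleLocusOpen»).  Cell `hodgecm-mathlib`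
(D-0151), FLOOR 0, P6 «MOD programme» (crux hLiu418 = stmt-HodgeConjecture-24832), SPREAD door, item (s2-λ) ∕ road «Θ-SPREAD» (LEAD F0P6-plan (g2)
RULINGS M-28 (3), M-28′, hands re-cut 22:56:58Z; B-p18 (g38)).  HC_CM is proved only modulo the printed citations until rung 0 closes; this file
is generic and changes no count.

ASSEMBLY of the (s2-λ) board BY NAME: hom spread ★ `exists_stage_monHom` (p846935) → `IsLambdaOfAt` transport to the stage at the generic
geometric points ★ `PolarizationSpreadTransport` (p847043) → the `hopen` swap ★ `PolarizationSpreadStageAmpleLocus` (p847084; ampleness half =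
★ «AmpleLocusOpen» FILE 4 p847074) with its two residues: `hsq` = ★ `LDeltaIsLambdaOfAtSqStage.isLambdaOfAt_sq_of_iso_LDelta` (p847114,
[MumfordFogartyKirwan1994] Prop. 6.10 at a flat stage, characteristic-free) and `hroot` = ★ `IsLambdaOfAtRootOfSquareAtPoint.exists_isAmple_isLambdaOfAt_of_isLambdaOfAt_sq_of_half`
(p847103, B-p02 (g22)) fed by the HALVING `half` — the exact head shape of ★ G4 §4 `IsLambdaOfAtSquareRoot.exists_isAmple_isLambdaOfAt_of_sq`
(characteristic `0`) ∕ organ O5 «HALF-`p`» (`(2 : Ω) ≠ 0`, B-p08 (g33), pending) — kept BY VALUE at the geometric points of the stage, where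
`2 ≠ 0` because `2` is inverted on the stage base (`h2`).  Remaining inputs BY VALUE, all in ★ currencies: `hD` (the unit clause
`𝒫|_{A × {ε_Â}} ≅ 𝒪` of the stage-`t` dual pair — ★ `AbelianSchemeDualPairNormalize` ∕ the P-2′ letter; base-changed by ★
`DualPair.nonempty_unitHatSlice_baseChange_iso`), `hdim` (`dim A_z̄ = dim Â_z̄` at the geometric points of the finer stages — ★ (W-hdim)
`DualPairFibreDimOfConnectedStage` p847071 currency), `half`.

* `two_ne_zero_of_isUnit_stage` — `2 ≠ 0` at the field-valued points of the stages above `t` when `2 ∈ A[1∕t]^×`.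
* `exists_stage_polarization_of_generic_polarization` — THE HEAD: `A` a domain, `K = Frac A` of characteristic `0`, `P → Spec A` qcqs, the stages
  `P ⊗ D(s)` locally Noetherian, `P ⊗ Spec K` locally Noetherian, the stage `t` flat, `2 ∈ A[1∕t]^×`; `𝒜ₜ` over `P ⊗ D(t)` with dual pair `Dₜ`
  (`hD`), `pol` a ★ `Polarization` of `(𝒜ₜ)_K` for `(Dₜ)_K`; under `hdim` and `half` BY VALUE: there are `σ : s₁ ⟶ t`, a homomorphism
  `λ₁ : 𝒜ₜ|ₛ₁ → Âₜ|ₛ₁` restricting to `pol.lam` along the relative leg (★ `facObjIso` clause), `ρ : s ⟶ s₁` and a ★ `Polarization` of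
  `(𝒜ₜ|ₛ₁) ×_{P⊗D(s₁)} (P ⊗ D(s))` for the base-changed dual pair with `lam = λ₁ ×_{P⊗D(s₁)} (P ⊗ D(s))`.

* (ED. 2, appended) `exists_stage_polarization_of_generic_polarization_of_isOfRelDim` — the same with the pointwise `hdim` DISCHARGED from the two
  relative-dimension clauses `𝒜ₜ.IsOfRelDim g`, `Dₜ.hat.IsOfRelDim g` (★ `DualPair.dim_hat_fibre_eq_of_isOfRelDim`, ★ `IsOfRelDim.baseChange` — the
  currency of GEN's `RGDInputsAt.relDim` and of the P-2′ letter's clause (ii); [MumfordAV1970] §13 Cor. 3 «`dim Â = dim A`»).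
* (ED. 3, appended) **`exists_stage_polarization_of_generic_polarization_of_isUnit_two`** — `half` DISCHARGED BY NAME by ★ O5 «HALF-`p`»
  `IsLambdaOfAtSquareRootOfTwoNeZero.exists_isLambdaOfAt_isAmple_of_sq_of_two_ne_zero` ([MumfordAV1970] §23 Thm. 3 at characteristic `≠ 2`, in-house):
  the (s2-λ) head with NO square-root binder — inputs `h2`, `hD`, `IsOfRelDim g` ×2 only.
* (ED. 4, appended) **`exists_stage_polarization_of_generic_polarization_of_isUnit_two'`** — the relative-dimension clauses DROPPED as well:
  `dim Â_z̄ = dim A_z̄` holds for EVERY dual pair of an abelian variety over any field (★ `DualPair.dim_hat_eq`, B-p08 (g33) p847199,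
  [MumfordAV1970] §13 Cor. 3) — inputs `h2` and `hD` ONLY.
* (ED. 5, appended) **`exists_stage_polarization_of_generic_polarization_of_isUnit_two''`** — the unit clause `hD` DISCHARGED INSIDE by
  renormalising the stage dual pair (`Dₜ ↦ Dₜ.normalize`, ★ `AbelianSchemeDualPairNormalize`: same `Â`, `𝒫|_{A × {ε_Â}} ≅ 𝒪`; the generic
  polarisation read for `Dₜ.normalize ×_{P_t} (P ⊗ Spec K)` by ★ `Polarization.exists_normalize_baseChange`) — input `2 ∈ A[1∕t]^×` ONLY; the
  output polarisation is for the NORMALISED stage pair `(Dₜ.normalize|ₛ₁)|ρ`.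

## References
* [MumfordFogartyKirwan1994] D. Mumford, J. Fogarty, F. Kirwan, *Geometric Invariant Theory*, 3rd ed. (1994), Ch. 6 §2 Def. 6.3 (p. 120), Prop. 6.10
  (p. 121); Ch. 7 §2 Def. 7.2 (p. 129).
* [GortzWedhorn2023] U. Görtz, T. Wedhorn, *Algebraic Geometry II* (2023), Thm. 24.46 (p. 397), Prop. 27.284 and Cor. 27.285 (p. 723).
* [MumfordAV1970] D. Mumford, *Abelian Varieties* (1970), §23 Thm. 3 (p. 231), §13 Cor. 3 (p. 130).
* [EGAIV3] A. Grothendieck, J. Dieudonné, *EGA IV₃* (1966), Thm. 8.8.2 (i), 11.10.5.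
* [GortzWedhorn2020] U. Görtz, T. Wedhorn, *Algebraic Geometry I*, 2nd ed. (2020), §(10.13) (localisation towers), §(4.7) Prop. 4.16.
-/

set_option autoImplicit false

noncomputable section

open CategoryTheory CategoryTheory.Limits AlgebraicGeometry MonoidalCategory CartesianMonoidalCategory
open scoped MonObj

namespace Literature.AlgebraicGeometry.AbelianSchemes

namespace AbelianSchemeOver

open Literature.AlgebraicGeometry.Motives Literature.AlgebraicGeometry.AbelianVarieties
open Literature.AlgebraicGeometry.Limits Literature.AlgebraicGeometry.Limits.LocApprox Literature.AlgebraicGeometry.Limits.OverFac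

section TwoUnit

variable {A : Type} [CommRing A] {S : Submonoid A} {P : SchemeOver A} {t : Idx S}

/-- `2 ≠ 0` in the field of a field-valued point of a finer stage `P ⊗ D(s₁)` when `2` is a unit of `A[1∕t]` (the point's field receives
`A[1∕t] → A[1∕s₁] → Ω`). [cite: GortzWedhorn2020, §(10.13)] -/
theorem two_ne_zero_of_isUnit_stage (h2 : IsUnit (2 : loc S t)) {s₁ : Idx S} (σ : s₁ ⟶ t)
    {Ω : Type} [Field Ω] (zb : Spec (.of Ω) ⟶ (P ⊗ (baseDiagram S).obj s₁).left) : (2 : Ω) ≠ 0 := by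
  let φ : loc S t →+* Ω :=
    (Spec.preimage (zb ≫ pullback.snd P.hom ((baseDiagram S).obj s₁).hom ≫ ((baseDiagram S).map σ).left)).hom
  have h := h2.map φ
  rw [map_ofNat] at h
  exact h.ne_zero

end TwoUnit

variable {A : Type} [CommRing A] [IsDomain A] (K : Type) [Field K] [CharZero K] [Algebra A K] [IsFractionRing A K]
  {P : SchemeOver A} [QuasiCompact P.hom] [QuasiSeparated P.hom]
  [∀ s : Idx (nonZeroDivisors A), IsLocallyNoetherian (P ⊗ (baseDiagram (nonZeroDivisors A)).obj s).left]
  [IsLocallyNoetherian (P ⊗ specOver A K).left]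
  {t : Idx (nonZeroDivisors A)} [Flat (pullback.snd P.hom ((baseDiagram (nonZeroDivisors A)).obj t).hom)]
  (𝒜ₜ : AbelianSchemeOver (P ⊗ (baseDiagram (nonZeroDivisors A)).obj t).left) (Dₜ : 𝒜ₜ.DualPair)
  (pol : (𝒜ₜ.baseChange (genOver (nonZeroDivisors A) K P t).hom).Polarization (Dₜ.baseChange (genOver (nonZeroDivisors A) K P t).hom))

/-- **(s2-λ) CLOSER: A POLARIZATION OF THE GENERIC BASE CHANGE SPREADS TO A POLARIZATION OVER A FINER STAGE, MODULO THE CHARACTERISTIC-`p`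
HALVING.**  `A` a domain, `K = Frac A` of characteristic `0`, `P → Spec A` quasi-compact quasi-separated, every stage base `P ⊗ D(s)` and the
generic base `P ⊗ Spec K` locally Noetherian, the stage `P ⊗ D(t) → D(t)` flat, `2` a unit of `A[1∕t]` (`h2`); `𝒜ₜ` an abelian scheme over
`P ⊗ D(t)` with dual pair `Dₜ = (Âₜ, 𝒫)` normalised along `A × {ε_Â}` (`hD`), `pol` a ★ `Polarization` ([MumfordFogartyKirwan1994] Def. 6.3) of
`(𝒜ₜ)_K` for `(Dₜ)_K`.  BY VALUE: (`hdim`) `dim A_z̄ = dim Â_z̄` at the geometric points of the finer stages (★ (W-hdim) currency); (`half`) the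
HALVING at the geometric points `z̄` of the finer stages (`2 ≠ 0` in `κ(z̄)`): «`λ̄²` onto on points, `Θ` ample with a non-zero section of an
odd multiple, `λ̄² = Λ(𝒪(Θ))` ⇒ `λ̄ = Λ(𝒪(Θ₁))` with `Θ₁` ample» — ★ G4 §4 at characteristic `0`, organ «HALF-`p`» at `p ≠ 2` ([MumfordAV1970]
§23 Thm. 3).  CONCLUSION: `σ : s₁ ⟶ t`, a homomorphism `λ₁ : 𝒜ₜ|ₛ₁ → Âₜ|ₛ₁` whose base change along the relative leg is `pol.lam` (★ `facObjIso`
clause), `ρ : s ⟶ s₁`, and a ★ `Polarization` of `(𝒜ₜ|ₛ₁) ×_{P⊗D(s₁)} (P ⊗ D(s))` for the base-changed dual pair with `lam = λ₁ ×_{P⊗D(s₁)} (P ⊗ D(s))`.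
Proof = ★ `exists_stage_monHom_hgen_of_polarization` + ★ `exists_stage_polarization_of_sq_root` with `hsq := ` ★ `isLambdaOfAt_sq_of_iso_LDelta`
and `hroot := ` ★ `exists_isAmple_isLambdaOfAt_of_isLambdaOfAt_sq_of_half`.
[cite: MumfordFogartyKirwan1994, Ch. 6 §2 Definition 6.3 (p. 120) and Proposition 6.10 (p. 121)] [cite: GortzWedhorn2023, Cor. 27.285 (p. 723)] [cite: MumfordAV1970, §23 Thm. 3 (p. 231)] [cite: EGAIV3, Thm. 8.8.2 (i)] -/
theorem exists_stage_polarization_of_generic_polarization (h2 : IsUnit (2 : loc (nonZeroDivisors A) t))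
    (hD : Nonempty ((Scheme.Modules.pullback (DualPair.unitHatSlice Dₜ)).obj Dₜ.P ≅ SheafOfModules.unit _))
    (hdim : ∀ (s₁ : Idx (nonZeroDivisors A)) (σ : s₁ ⟶ t) (Ω : Type) [Field Ω] [IsAlgClosed Ω]
      (zb : Spec (.of Ω) ⟶ (P ⊗ (baseDiagram (nonZeroDivisors A)).obj s₁).left),
      ((𝒜ₜ.baseChange (stageOver (nonZeroDivisors A) P σ).hom).fibre zb).toAbelianVariety.dim =
        ((Dₜ.baseChange (stageOver (nonZeroDivisors A) P σ).hom).hat.fibre zb).toAbelianVariety.dim)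
    (half : ∀ (s₁ : Idx (nonZeroDivisors A)) (σ : s₁ ⟶ t)
      (lam : (𝒜ₜ.baseChange (stageOver (nonZeroDivisors A) P σ).hom).X ⟶ (Dₜ.baseChange (stageOver (nonZeroDivisors A) P σ).hom).hat.X)
      [IsMonHom lam] (Ω : Type) [Field Ω] [IsAlgClosed Ω] (zb : Spec (.of Ω) ⟶ (P ⊗ (baseDiagram (nonZeroDivisors A)).obj s₁).left),
      (2 : Ω) ≠ 0 →
      (∀ y : (Dₜ.baseChange (stageOver (nonZeroDivisors A) P σ).hom).hat.FibrePoints zb,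
        ∃ x : (𝒜ₜ.baseChange (stageOver (nonZeroDivisors A) P σ).hom).FibrePoints zb, x ≫ (lam ^ 2) = y) →
      ∀ ⦃Θ : CartierDivisor ((𝒜ₜ.baseChange (stageOver (nonZeroDivisors A) P σ).hom).fibre zb).toAbelianVariety.X.left⦄, Θ.IsAmple →
      ∀ ⦃N : ℕ⦄, Odd N →
      ∀ ⦃s₀ : ((𝒜ₜ.baseChange (stageOver (nonZeroDivisors A) P σ).hom).fibre zb).toAbelianVariety.X.left.functionField⦄, s₀ ≠ 0 →
        (N • Θ).IsSection s₀ →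
        (𝒜ₜ.baseChange (stageOver (nonZeroDivisors A) P σ).hom).IsLambdaOfAt zb (Dₜ.baseChange (stageOver (nonZeroDivisors A) P σ).hom)
          (lam ^ 2) Θ →
        ∃ Θ₁ : CartierDivisor ((𝒜ₜ.baseChange (stageOver (nonZeroDivisors A) P σ).hom).fibre zb).toAbelianVariety.X.left,
          Θ₁.IsAmple ∧ (𝒜ₜ.baseChange (stageOver (nonZeroDivisors A) P σ).hom).IsLambdaOfAt zb
            (Dₜ.baseChange (stageOver (nonZeroDivisors A) P σ).hom) lam Θ₁) :
    ∃ (s₁ : Idx (nonZeroDivisors A)) (σ : s₁ ⟶ t)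
      (lam₁ : (𝒜ₜ.baseChange (stageOver (nonZeroDivisors A) P σ).hom).X ⟶ (Dₜ.baseChange (stageOver (nonZeroDivisors A) P σ).hom).hat.X)
      (_ : IsMonHom lam₁)
      (_ : (Over.pullback (relLeg (nonZeroDivisors A) K P σ).left).map lam₁ ≫ (facObjIso (relLeg (nonZeroDivisors A) K P σ) Dₜ.hat.X).hom =
        (facObjIso (relLeg (nonZeroDivisors A) K P σ) 𝒜ₜ.X).hom ≫ pol.lam)
      (s : Idx (nonZeroDivisors A)) (ρ : s ⟶ s₁)
      (pol₁ : ((𝒜ₜ.baseChange (stageOver (nonZeroDivisors A) P σ).hom).baseChange (stageOver (nonZeroDivisors A) P ρ).hom).Polarization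
        ((Dₜ.baseChange (stageOver (nonZeroDivisors A) P σ).hom).baseChange (stageOver (nonZeroDivisors A) P ρ).hom)),
      pol₁.lam = (Over.pullback (stageOver (nonZeroDivisors A) P ρ).hom).map lam₁ := by
  obtain ⟨s₁, σ, lam₁, hmon, hz, hgen⟩ := exists_stage_monHom_hgen_of_polarization K 𝒜ₜ Dₜ pol
  haveI := hmon
  haveI : Flat (pullback.snd P.hom ((baseDiagram (nonZeroDivisors A)).obj s₁).hom) :=
    MorphismProperty.of_isPullback (SubalgApprox.isPullback_whiskerLeft_left P ((baseDiagram (nonZeroDivisors A)).map σ)) ‹_›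
  let 𝒜₁ := 𝒜ₜ.baseChange (stageOver (nonZeroDivisors A) P σ).hom
  let D₁ : 𝒜₁.DualPair := Dₜ.baseChange (stageOver (nonZeroDivisors A) P σ).hom
  haveI : IsLocallyNoetherian (stageOver (nonZeroDivisors A) P σ).left :=
    inferInstanceAs (IsLocallyNoetherian (P ⊗ (baseDiagram (nonZeroDivisors A)).obj s₁).left)
  -- the graph of `λ₁`
  obtain ⟨Gr, hGr₁, hGr₂⟩ : ∃ Gr : 𝒜₁.X.left ⟶ 𝒜₁.prodLeft D₁.hat,
      Gr ≫ pullback.fst 𝒜₁.X.hom D₁.hat.X.hom = 𝟙 _ ∧ Gr ≫ pullback.snd 𝒜₁.X.hom D₁.hat.X.hom = lam₁.left :=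
    ⟨pullback.lift (𝟙 _) lam₁.left (by rw [Category.id_comp, Over.w]), pullback.lift_fst _ _ _, pullback.lift_snd _ _ _⟩
  -- the unit clause of the stage dual pair
  have hD₁ : Nonempty ((Scheme.Modules.pullback (DualPair.unitHatSlice D₁)).obj D₁.P ≅ SheafOfModules.unit _) :=
    Dₜ.nonempty_unitHatSlice_baseChange_iso hD
  -- `hsq` by name (★ `LDeltaIsLambdaOfAtSqStage`), `hroot` by name (★ `IsLambdaOfAtRootOfSquareAtPoint`) modulo `half`
  obtain ⟨s, ρ, pol₁, hpol₁⟩ := @exists_stage_polarization_of_sq_root A _ (nonZeroDivisors A) K _ _ _ _ P _ s₁ _ 𝒜₁ D₁ lam₁ hmon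
    Gr hGr₁ hGr₂ hgen
    (fun Ω _ _ zb Θ₂ e => isLambdaOfAt_sq_of_iso_LDelta K σ 𝒜ₜ Dₜ pol lam₁ hz Gr hGr₁ hGr₂ hD₁ zb Θ₂ e)
    (fun Ω _ _ zb Θ₂ hΘ₂ hsq' => exists_isAmple_isLambdaOfAt_of_isLambdaOfAt_sq_of_half 𝒜₁ D₁ zb
      (fun Θ hΘ N hN s₀ hs₀ hsec h hsurj =>
        half s₁ σ lam₁ Ω zb (two_ne_zero_of_isUnit_stage (P := P) h2 σ zb) hsurj hΘ hN hs₀ hsec h)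
      hsq' hΘ₂ (hdim s₁ σ Ω zb))
  exact ⟨s₁, σ, lam₁, hmon, hz, s, ρ, pol₁, hpol₁⟩

/-- **(s2-λ) CLOSER, ED. 2 form: the pointwise `hdim` DISCHARGED by the relative-dimension clauses.**  Same as
`exists_stage_polarization_of_generic_polarization` with `hdim` replaced by `hA : 𝒜ₜ.IsOfRelDim g` and `hÂ : Dₜ.hat.IsOfRelDim g` ([MumfordAV1970] §13
Cor. 3 «`dim Â = dim A`»; the currency of the P-2′ letter's clause (ii) and of GEN's `relDim`): both clauses base-change to every stage (★
`IsOfRelDim.baseChange`, ★ `DualPair.isOfRelDim_hat_baseChange`) and give `dim A_z̄ = dim Â_z̄` at every field-valued point (★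
`DualPair.dim_hat_fibre_eq_of_isOfRelDim`). [cite: MumfordAV1970, §13 Cor. 3 (p. 130) and §23 Thm. 3 (p. 231)]
[cite: MumfordFogartyKirwan1994, Ch. 6 §2 Definition 6.3 (p. 120) and Proposition 6.10 (p. 121)] [cite: GortzWedhorn2023, Cor. 27.285 (p. 723)] -/
theorem exists_stage_polarization_of_generic_polarization_of_isOfRelDim (h2 : IsUnit (2 : loc (nonZeroDivisors A) t))
    (hD : Nonempty ((Scheme.Modules.pullback (DualPair.unitHatSlice Dₜ)).obj Dₜ.P ≅ SheafOfModules.unit _))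
    {g : ℕ} (hA : 𝒜ₜ.IsOfRelDim g) (hÂ : Dₜ.hat.IsOfRelDim g)
    (half : ∀ (s₁ : Idx (nonZeroDivisors A)) (σ : s₁ ⟶ t)
      (lam : (𝒜ₜ.baseChange (stageOver (nonZeroDivisors A) P σ).hom).X ⟶ (Dₜ.baseChange (stageOver (nonZeroDivisors A) P σ).hom).hat.X)
      [IsMonHom lam] (Ω : Type) [Field Ω] [IsAlgClosed Ω] (zb : Spec (.of Ω) ⟶ (P ⊗ (baseDiagram (nonZeroDivisors A)).obj s₁).left),
      (2 : Ω) ≠ 0 →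
      (∀ y : (Dₜ.baseChange (stageOver (nonZeroDivisors A) P σ).hom).hat.FibrePoints zb,
        ∃ x : (𝒜ₜ.baseChange (stageOver (nonZeroDivisors A) P σ).hom).FibrePoints zb, x ≫ (lam ^ 2) = y) →
      ∀ ⦃Θ : CartierDivisor ((𝒜ₜ.baseChange (stageOver (nonZeroDivisors A) P σ).hom).fibre zb).toAbelianVariety.X.left⦄, Θ.IsAmple →
      ∀ ⦃N : ℕ⦄, Odd N →
      ∀ ⦃s₀ : ((𝒜ₜ.baseChange (stageOver (nonZeroDivisors A) P σ).hom).fibre zb).toAbelianVariety.X.left.functionField⦄, s₀ ≠ 0 →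
        (N • Θ).IsSection s₀ →
        (𝒜ₜ.baseChange (stageOver (nonZeroDivisors A) P σ).hom).IsLambdaOfAt zb (Dₜ.baseChange (stageOver (nonZeroDivisors A) P σ).hom)
          (lam ^ 2) Θ →
        ∃ Θ₁ : CartierDivisor ((𝒜ₜ.baseChange (stageOver (nonZeroDivisors A) P σ).hom).fibre zb).toAbelianVariety.X.left,
          Θ₁.IsAmple ∧ (𝒜ₜ.baseChange (stageOver (nonZeroDivisors A) P σ).hom).IsLambdaOfAt zb
            (Dₜ.baseChange (stageOver (nonZeroDivisors A) P σ).hom) lam Θ₁) :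
    ∃ (s₁ : Idx (nonZeroDivisors A)) (σ : s₁ ⟶ t)
      (lam₁ : (𝒜ₜ.baseChange (stageOver (nonZeroDivisors A) P σ).hom).X ⟶ (Dₜ.baseChange (stageOver (nonZeroDivisors A) P σ).hom).hat.X)
      (_ : IsMonHom lam₁)
      (_ : (Over.pullback (relLeg (nonZeroDivisors A) K P σ).left).map lam₁ ≫ (facObjIso (relLeg (nonZeroDivisors A) K P σ) Dₜ.hat.X).hom =
        (facObjIso (relLeg (nonZeroDivisors A) K P σ) 𝒜ₜ.X).hom ≫ pol.lam)
      (s : Idx (nonZeroDivisors A)) (ρ : s ⟶ s₁)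
      (pol₁ : ((𝒜ₜ.baseChange (stageOver (nonZeroDivisors A) P σ).hom).baseChange (stageOver (nonZeroDivisors A) P ρ).hom).Polarization
        ((Dₜ.baseChange (stageOver (nonZeroDivisors A) P σ).hom).baseChange (stageOver (nonZeroDivisors A) P ρ).hom)),
      pol₁.lam = (Over.pullback (stageOver (nonZeroDivisors A) P ρ).hom).map lam₁ :=
  exists_stage_polarization_of_generic_polarization K 𝒜ₜ Dₜ pol h2 hD
    (fun _ σ _ _ _ zb => ((Dₜ.baseChange (stageOver (nonZeroDivisors A) P σ).hom).dim_hat_fibre_eq_of_isOfRelDim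
      (hA.baseChange _) (Dₜ.isOfRelDim_hat_baseChange _ hÂ) zb).symm)
    half

/-- **(s2-λ) CLOSER, ED. 3 form — THE SQUARE ROOT DISCHARGED: a polarization of the generic base change spreads to a ★ `Polarization` over a
finer stage, given only `2 ∈ A[1∕t]^×`, the unit clause of `Dₜ` and the two relative-dimension clauses.**  Same as
`exists_stage_polarization_of_generic_polarization_of_isOfRelDim` with `half` supplied BY NAME by ★ O5 «HALF-`p`»
`exists_isLambdaOfAt_isAmple_of_sq_of_two_ne_zero` ([MumfordAV1970] §23 Thm. 3 at `n = 2` over an algebraically closed field with `2 ≠ 0`: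
`π : A∕A[2] → A` is an isomorphism by étale cancellation and universal injectivity, theta-function eigendivisor, Néron–Severi bookkeeping).
[cite: MumfordAV1970, §23 Thm. 3 (p. 231) and §13 Cor. 3 (p. 130)] [cite: MumfordFogartyKirwan1994, Ch. 6 §2 Definition 6.3 (p. 120) and Proposition 6.10 (p. 121)]
[cite: GortzWedhorn2023, Cor. 27.285 (p. 723)] [cite: EGAIV3, Thm. 8.8.2 (i)] -/
theorem exists_stage_polarization_of_generic_polarization_of_isUnit_two (h2 : IsUnit (2 : loc (nonZeroDivisors A) t))
    (hD : Nonempty ((Scheme.Modules.pullback (DualPair.unitHatSlice Dₜ)).obj Dₜ.P ≅ SheafOfModules.unit _))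
    {g : ℕ} (hA : 𝒜ₜ.IsOfRelDim g) (hÂ : Dₜ.hat.IsOfRelDim g) :
    ∃ (s₁ : Idx (nonZeroDivisors A)) (σ : s₁ ⟶ t)
      (lam₁ : (𝒜ₜ.baseChange (stageOver (nonZeroDivisors A) P σ).hom).X ⟶ (Dₜ.baseChange (stageOver (nonZeroDivisors A) P σ).hom).hat.X)
      (_ : IsMonHom lam₁)
      (_ : (Over.pullback (relLeg (nonZeroDivisors A) K P σ).left).map lam₁ ≫ (facObjIso (relLeg (nonZeroDivisors A) K P σ) Dₜ.hat.X).hom =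
        (facObjIso (relLeg (nonZeroDivisors A) K P σ) 𝒜ₜ.X).hom ≫ pol.lam)
      (s : Idx (nonZeroDivisors A)) (ρ : s ⟶ s₁)
      (pol₁ : ((𝒜ₜ.baseChange (stageOver (nonZeroDivisors A) P σ).hom).baseChange (stageOver (nonZeroDivisors A) P ρ).hom).Polarization
        ((Dₜ.baseChange (stageOver (nonZeroDivisors A) P σ).hom).baseChange (stageOver (nonZeroDivisors A) P ρ).hom)),
      pol₁.lam = (Over.pullback (stageOver (nonZeroDivisors A) P ρ).hom).map lam₁ :=
  exists_stage_polarization_of_generic_polarization_of_isOfRelDim K 𝒜ₜ Dₜ pol h2 hD hA hÂ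
    fun _ σ lam _ _ _ _ zb h2Ω hsurj _ hΘ _ hN _ hs₀ hsec h => by
      obtain ⟨Θ₁, hΛ, hamp⟩ := (𝒜ₜ.baseChange (stageOver (nonZeroDivisors A) P σ).hom).exists_isLambdaOfAt_isAmple_of_sq_of_two_ne_zero
        (Dₜ.baseChange (stageOver (nonZeroDivisors A) P σ).hom) zb h2Ω (lam := lam) hsurj hΘ hN hs₀ hsec h
      exact ⟨Θ₁, hamp, hΛ⟩

/-- **(s2-λ) CLOSER, ED. 4 form — INPUTS `2 ∈ A[1∕t]^×` AND THE UNIT CLAUSE OF `Dₜ` ONLY.**  Same as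
`exists_stage_polarization_of_generic_polarization_of_isUnit_two` with the relative-dimension clauses dropped: at every field-valued point `dim Â_z̄ = dim A_z̄`
holds for EVERY dual pair of an abelian variety (★ `DualPair.dim_hat_eq`, [MumfordAV1970] §13 Cor. 3 «`dim Â = dim A`», Weil monomorphism + `Λ(ample)`),
read on the fibre `(𝒜ₜ|ₛ₁)_z̄` with the base-changed dual pair `(Dₜ|ₛ₁) ×_{P⊗D(s₁)} z̄` (★ `fibre` ∕ ★ `baseChange_hat` definitional bridges).
[cite: MumfordAV1970, §13 Cor. 3 (p. 130) and §23 Thm. 3 (p. 231)] [cite: MumfordFogartyKirwan1994, Ch. 6 §2 Definition 6.3 (p. 120) and Proposition 6.10 (p. 121)]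
[cite: GortzWedhorn2023, Cor. 27.285 (p. 723)] [cite: EGAIV3, Thm. 8.8.2 (i)] -/
theorem exists_stage_polarization_of_generic_polarization_of_isUnit_two' (h2 : IsUnit (2 : loc (nonZeroDivisors A) t))
    (hD : Nonempty ((Scheme.Modules.pullback (DualPair.unitHatSlice Dₜ)).obj Dₜ.P ≅ SheafOfModules.unit _)) :
    ∃ (s₁ : Idx (nonZeroDivisors A)) (σ : s₁ ⟶ t)
      (lam₁ : (𝒜ₜ.baseChange (stageOver (nonZeroDivisors A) P σ).hom).X ⟶ (Dₜ.baseChange (stageOver (nonZeroDivisors A) P σ).hom).hat.X)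
      (_ : IsMonHom lam₁)
      (_ : (Over.pullback (relLeg (nonZeroDivisors A) K P σ).left).map lam₁ ≫ (facObjIso (relLeg (nonZeroDivisors A) K P σ) Dₜ.hat.X).hom =
        (facObjIso (relLeg (nonZeroDivisors A) K P σ) 𝒜ₜ.X).hom ≫ pol.lam)
      (s : Idx (nonZeroDivisors A)) (ρ : s ⟶ s₁)
      (pol₁ : ((𝒜ₜ.baseChange (stageOver (nonZeroDivisors A) P σ).hom).baseChange (stageOver (nonZeroDivisors A) P ρ).hom).Polarization
        ((Dₜ.baseChange (stageOver (nonZeroDivisors A) P σ).hom).baseChange (stageOver (nonZeroDivisors A) P ρ).hom)),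
      pol₁.lam = (Over.pullback (stageOver (nonZeroDivisors A) P ρ).hom).map lam₁ :=
  exists_stage_polarization_of_generic_polarization K 𝒜ₜ Dₜ pol h2 hD
    (fun _ σ _ _ _ zb => (DualPair.dim_hat_eq ((𝒜ₜ.baseChange (stageOver (nonZeroDivisors A) P σ).hom).fibre zb).toAbelianVariety
      ((Dₜ.baseChange (stageOver (nonZeroDivisors A) P σ).hom).baseChange zb)).symm)
    fun _ σ lam _ _ _ _ zb h2Ω hsurj _ hΘ _ hN _ hs₀ hsec h => by
      obtain ⟨Θ₁, hΛ, hamp⟩ := (𝒜ₜ.baseChange (stageOver (nonZeroDivisors A) P σ).hom).exists_isLambdaOfAt_isAmple_of_sq_of_two_ne_zero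
        (Dₜ.baseChange (stageOver (nonZeroDivisors A) P σ).hom) zb h2Ω (lam := lam) hsurj hΘ hN hs₀ hsec h
      exact ⟨Θ₁, hamp, hΛ⟩

/-- **(s2-λ′) CLOSER, ED. 5 form — INPUT `2 ∈ A[1∕t]^×` ONLY.**  For ANY dual pair `Dₜ` of `𝒜ₜ` and a ★ `Polarization` `pol` of the generic base
change `(𝒜ₜ)_K` for `Dₜ ×_{P_t} (P ⊗ Spec K)`: there are `σ : s₁ ⟶ t`, a homomorphism `λ₁ : 𝒜ₜ|ₛ₁ → Âₜ|ₛ₁` restricting to `pol.lam` along the relative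
leg (★ `facObjIso` clause; `Dₜ.normalize` has the same `Âₜ`), `ρ : s ⟶ s₁` and a ★ `Polarization` of `(𝒜ₜ|ₛ₁) ×_{P⊗D(s₁)} (P ⊗ D(s))` for the
NORMALISED stage dual pair `(Dₜ.normalize|ₛ₁) ×_{P⊗D(s₁)} (P ⊗ D(s))` with `lam = λ₁ ×_{P⊗D(s₁)} (P ⊗ D(s))`.  Proof: ★ `Polarization.exists_normalize_baseChange`
reads `pol` for `Dₜ.normalize ×_{P_t} (P ⊗ Spec K)` (same `λ`); the unit clause of `Dₜ.normalize` is ★ `nonempty_unitHatSlice_iso_normalize`;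
`exists_stage_polarization_of_generic_polarization_of_isUnit_two'`. [cite: MumfordFogartyKirwan1994, Ch. 6 §2 Definition 6.3 (p. 120) and §2 (p. 121)]
[cite: MumfordAV1970, §23 Thm. 3 (p. 231) and §13 Cor. 3 (p. 130)] [cite: GortzWedhorn2023, Cor. 27.285 (p. 723)] [cite: EGAIV3, Thm. 8.8.2 (i)] -/
theorem exists_stage_polarization_of_generic_polarization_of_isUnit_two'' (h2 : IsUnit (2 : loc (nonZeroDivisors A) t)) :
    ∃ (s₁ : Idx (nonZeroDivisors A)) (σ : s₁ ⟶ t)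
      (lam₁ : (𝒜ₜ.baseChange (stageOver (nonZeroDivisors A) P σ).hom).X ⟶
        (Dₜ.normalize.baseChange (stageOver (nonZeroDivisors A) P σ).hom).hat.X)
      (_ : IsMonHom lam₁)
      (_ : (Over.pullback (relLeg (nonZeroDivisors A) K P σ).left).map lam₁ ≫
          (facObjIso (relLeg (nonZeroDivisors A) K P σ) Dₜ.normalize.hat.X).hom =
        (facObjIso (relLeg (nonZeroDivisors A) K P σ) 𝒜ₜ.X).hom ≫ pol.lam)
      (s : Idx (nonZeroDivisors A)) (ρ : s ⟶ s₁)
      (pol₁ : ((𝒜ₜ.baseChange (stageOver (nonZeroDivisors A) P σ).hom).baseChange (stageOver (nonZeroDivisors A) P ρ).hom).Polarization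
        ((Dₜ.normalize.baseChange (stageOver (nonZeroDivisors A) P σ).hom).baseChange (stageOver (nonZeroDivisors A) P ρ).hom)),
      pol₁.lam = (Over.pullback (stageOver (nonZeroDivisors A) P ρ).hom).map lam₁ := by
  obtain ⟨polN, hN⟩ := pol.exists_normalize_baseChange Dₜ (genOver (nonZeroDivisors A) K P t).hom
  obtain ⟨s₁, σ, lam₁, hmon, hz, s, ρ, pol₁, h⟩ := exists_stage_polarization_of_generic_polarization_of_isUnit_two' K 𝒜ₜ Dₜ.normalize polN
    h2 Dₜ.nonempty_unitHatSlice_iso_normalize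
  refine ⟨s₁, σ, lam₁, hmon, ?_, s, ρ, pol₁, h⟩
  rw [← hN]
  exact hz

end AbelianSchemeOver

end Literature.AlgebraicGeometry.AbelianSchemes

end
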